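import Literature.NumberTheory.EllipticCurves.NonvanishingTwistsPrescribedLocalComponents
import Summits.BirchSwinnertonDyer.BirchSwinnertonDyer.Theorems.AdditiveBranchIMCGordTwoTwistedWanDefs
import HarnessLib

/-!
# E3′ rank-one FIELD ONE on the cut without an additive `2` — `FieldOneTwistedCutOne` from reading R5 (pen bsd-addord-plan g45 DRAFT, 2026-08-31T01:30Z; `lean check` rc 0, SORRY-FREE, 7 s)

CRUX WORKFILE (`Cruxes/GordTwoRankOne/FieldOneTwistedCutOneDraft.lean`) for the registered stub `stub_fieldOneTwisted :
TwistedWanRoad.FieldOneTwistedCutOne` of 19358 `wan_tame_bdp_road` v28 (16029718b88dd64f). It is written in THEOREMS STYLE (namespace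
`Summit.BirchSwinnertonDyer.BirchSwinnertonDyer.Theorems.TwistedWanRoad`, sorry-free) so that a prover / the LEAD can land it VERBATIM as
`Theorems/AdditiveBranchIMCGordTwoTwistedFieldOne.lean` (`ledger propose --kind proof --target … --supports stmt-BirchSwinnertonDyer-19358 --as helper`);
the pen does not propose proofs. After it lands, 19358 v29 closes the stub BY NAME:
`theorem fieldOneTwisted_closed : TwistedWanRoad.FieldOneTwistedCutOne :=
  TwistedWanRoad.fieldOneTwistedCutOne_of_fh stub_printedFactsTame.2.2.2.2.2.2.2.2.2.2.2.1` (R5 = `PrintedFactsTwisted.1`, the twelfth conjunct's head).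

THE PROOF (ten lines of bookkeeping, no engine beyond the tree's): reading R5's PROVED class-form corollary
`Literature.NumberTheory.EllipticCurves.exists_ramifiedClassAt_split_twist_ne_zero` (p789888; Friedberg–Hoffstein 1995 Thm B on the class
`𝒟(χ;S₀)` with the seed built in-kernel by Dirichlet + CRT) asks for the sign `w(E^{(d_K)}) = +1` UNIFORMLY on the class «`K` imaginary quadratic,
`d_K < −4`, `ℓ₀ ∣ d_K` with `d_K/ℓ₀*` in the Legendre class `s`, every prime of `N_E` other than `ℓ₀` split, `2` split if `2 ∤ N_E`, Heegner
hypothesis at `p`»; with `s :=` the `NonsplitClassAt` sign (`−1` if `E^{(ℓ₀*)}` is split multiplicative at `ℓ₀`, else `+1`) every member of that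
class is a `TameRoadFieldTwisted E p ℓ₀ K`, and the LEAD's engine on every odd row `TwistedWanRoad.engineTwistedNoAddTwo_holds` (p797470 read
through the predicates, p797577) gives `w(E^{(d_K)}) = −w(E) = +1`. The corollary then returns `K` in the class with `|d_K| > B` and
`L(E^{(d_K)}, 1) ≠ 0`, which is `FieldOneTwistedCutOne`'s conclusion.
-/

set_option linter.dupNamespace false

noncomputable section

open scoped Classical

open NumberField WeierstrassCurve Literature.NumberTheory.EllipticCurves
open Summit.BirchSwinnertonDyer.Rank1Residual
open Summit.BirchSwinnertonDyer.Rank1Residual.Additive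
open Summit.BirchSwinnertonDyer.BirchSwinnertonDyer.Theorems

namespace Summit.BirchSwinnertonDyer.BirchSwinnertonDyer.Theorems.TwistedWanRoad

/-- Every field of reading R5's class at the `NonsplitClassAt` sign is a `TameRoadFieldTwisted` (pure repackaging; `primeStar ℓ` is
`(-1) ^ (ℓ / 2) * ℓ` by `rfl`). -/
theorem tameRoadFieldTwisted_of_class (W : WeierstrassCurve ℚ) [W.IsElliptic] [W.IsGloballyMinimal] (p ℓ : ℕ) [Fact ℓ.Prime]
    (hWan : TwistedWanPrime W p ℓ) (K : Type) [Field K] [NumberField K] (hIQ : IsImaginaryQuadratic K)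
    (hlt : NumberField.discr K < -4) (hℓK : (ℓ : ℤ) ∣ NumberField.discr K)
    (hleg : legendreSym ℓ (NumberField.discr K / ((-1) ^ (ℓ / 2) * ℓ)) =
      (if (W.quadraticTwist ((primeStar ℓ : ℤ) : ℚ)).HasSplitMultiplicativeReductionAtPrime ℓ then -1 else 1))
    (hsplit : ∀ r : ℕ, r.Prime → r ∣ W.conductorNorm ℤ → r ≠ ℓ → ((Ideal.span {(r : ℤ)}).primesOver (𝓞 K)).ncard = 2)
    (h2 : ¬ 2 ∣ W.conductorNorm ℤ → ((Ideal.span {(2 : ℤ)}).primesOver (𝓞 K)).ncard = 2)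
    (hH : SatisfiesHeegnerHypothesis p K) : TameRoadFieldTwisted W p ℓ K :=
  ⟨hIQ, hlt, hWan, ⟨hℓK, by rw [primeStar_eq]; exact hleg⟩, hsplit, h2, hH⟩

/-- **`FieldOneTwistedCutOne` FROM READING R5** (Friedberg–Hoffstein 1995 Thm B with prescribed local components, the named fact
`friedbergHoffstein_exists_twist_prescribedLocalComponents`, p789888) — closes 19358's `stub_fieldOneTwisted` modulo print. -/
theorem fieldOneTwistedCutOne_of_fh (h : friedbergHoffstein_exists_twist_prescribedLocalComponents) : FieldOneTwistedCutOne := by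
  intro W _ _ hmod htt h2 hw p ℓ _ hp hp2 hWan B
  have hℓp : ℓ ≠ p := hWan.1
  have hℓ2 : ℓ ≠ 2 := hWan.2.1
  set s : ℤ := (if (W.quadraticTwist ((primeStar ℓ : ℤ) : ℚ)).HasSplitMultiplicativeReductionAtPrime ℓ then -1 else 1) with hs_def
  have hs : s = 1 ∨ s = -1 := by
    by_cases hsp : (W.quadraticTwist ((primeStar ℓ : ℤ) : ℚ)).HasSplitMultiplicativeReductionAtPrime ℓ
    · exact Or.inr (by simp [hs_def, hsp])
    · exact Or.inl (by simp [hs_def, hsp])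
  -- the sign is `+1` uniformly on the class: every member is a `TameRoadFieldTwisted`, and the odd-row engine flips `w(E) = −1`
  have hsign : ∀ (K : Type) [Field K] [NumberField K], IsImaginaryQuadratic K →
      NumberField.discr K < -4 → (ℓ : ℤ) ∣ NumberField.discr K →
      legendreSym ℓ (NumberField.discr K / ((-1) ^ (ℓ / 2) * ℓ)) = s →
      (∀ r : ℕ, r.Prime → r ∣ W.conductorNorm ℤ → r ≠ ℓ →
        ((Ideal.span {(r : ℤ)}).primesOver (𝓞 K)).ncard = 2) →
      (¬ 2 ∣ W.conductorNorm ℤ → ((Ideal.span {(2 : ℤ)}).primesOver (𝓞 K)).ncard = 2) →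
      SatisfiesHeegnerHypothesis p K → (W.quadraticTwist (NumberField.discr K : ℚ)).rootNumber = 1 := by
    intro K _ _ hIQ hlt hℓK hleg hsplit h2s hH
    have hT : TameRoadFieldTwisted W p ℓ K :=
      tameRoadFieldTwisted_of_class W p ℓ hWan K hIQ hlt hℓK (by rw [hleg]) hsplit h2s hH
    rw [engineTwistedNoAddTwo_holds W hmod htt h2 p ℓ K hT, hw]
    norm_num
  obtain ⟨K, iF, iN, hK, hlt, hB, hℓK, hleg, hsplit, h2s, hH, hL⟩ :=
    exists_ramifiedClassAt_split_twist_ne_zero W h ℓ hℓ2 hp (Ne.symm hℓp) hs hsign B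
  exact ⟨K, iF, iN, tameRoadFieldTwisted_of_class W p ℓ hWan K hK hlt hℓK (by rw [hleg]) hsplit h2s hH, hB, hL⟩

end Summit.BirchSwinnertonDyer.BirchSwinnertonDyer.Theorems.TwistedWanRoad

end
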